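import Literature.NumberTheory.EllipticCurves.PAdicBSD
import Literature.NumberTheory.EllipticCurves.PAdicBSDInterpolationProofs
import Literature.NumberTheory.EllipticCurves.IwasawaLeadingTermProofs
import Literature.NumberTheory.EllipticCurves.LeadingTermPPartProofs
import Literature.NumberTheory.EllipticCurves.AnalyticRankOrderProofs
import Literature.NumberTheory.EllipticCurves.CuspFormLFunctionAnalyticRankProofs
import Literature.NumberTheory.EllipticCurves.ZpCorankQuasiIso

/-!
# BirchSwinnertonDyer / PAdicOrderV2 — crux `PAdicOrderPadicBSDrankR2` (stmt-0490), line `Sketch`,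
# stub `stub_padicBSDrank_levelZero`: the level `ord_{T=0} L_p(E,T) = 0`, every good ordinary `p`

Registered stub of the skeleton `Cruxes/PAdicOrderPadicBSDrankR2/Lines/Sketch.lean` (idea
`pconverse-corank-split`). For `E/ℚ` (globally minimal `W`), a good ordinary prime `p` (`p = 2`
included) and the newform `f` of `E`, with `L_p(E,T) = padicLFunction f (unitRoot W p) ∈ ℚ_p⟦T⟧`:

* `ord_{T=0} L_p(E,T) = 0 ↔ ord_{s=1} L(E,s) = 0`, unconditionally;
* granting Kato's finiteness theorem `L(E,1) ≠ 0 ⇒ Sel_{p^∞}(E/ℚ)` finite (the named fact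
  `kato_finite_of_L_one_ne_zero`, Kato 2004 Cor. 14.3 = Kolyvagin), `ord_{T=0} L_p(E,T) = 0 ⇒
  corank_{ℤ_p} Sel_{p^∞}(E/ℚ) = 0`.

Proof. The constant term of `L_p(E,T)` is `L_p(E,0) = (1 - α⁻¹)² [0]⁺_f`
(`constantCoeff_padicLFunction_unitRoot`, the tree's PROVED interpolation theorem,
Mazur–Tate–Teitelbaum 1986 §I.14 (14.3)), where `1 - α⁻¹ = u · #Ẽ(𝔽_p) ≠ 0` (`u ∈ ℤ_pˣ`,
`exists_unit_one_sub_unitRoot_inv`, `reductionPointCount_pos`) and `[0]⁺_f · Ω⁺_f = L(E,1)` with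
`Ω⁺_f > 0` (`IsNewformOf.entireLFunction_one_eq`, `IsNewformOf.ratPlusSymbol_zero_mul_plusPeriod`,
`IsNewform0.plusPeriod_pos_holds`). Hence `ord_T L_p = 0 ↔ L_p(E,0) ≠ 0 ↔ L(E,1) ≠ 0 ↔ r_an = 0`
(`analyticRank_eq_zero_iff_holds`, `L(E,s)` entire for the modular `E`:
`IsNewformOf.hasEntireLFunction`). If `ord_T L_p = 0` then `L(E,1) ≠ 0`, Kato gives
`Sel_{p^∞}(E/ℚ)` finite, and a finite group has `ℤ_p`-corank `0` (`zpCorank_of_finite_eq_zero`).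
Everything except the hypothesis `hKF` is proved in the tree.
-/

-- D-0017: single-problem summit, so `Summit.BirchSwinnertonDyer.BirchSwinnertonDyer.…` repeats a
-- namespace BY DESIGN.
set_option linter.dupNamespace false

namespace Summit.BirchSwinnertonDyer.BirchSwinnertonDyer.Theorems

open scoped MatrixGroups ModularForm
open CongruenceSubgroup Literature.NumberTheory.EllipticCurves
  Literature.NumberTheory.EllipticCurves.ModularForms

/-- **The Euler-type factor `1 - α⁻¹` of the interpolation formula is non-zero** at a good
ordinary prime `p` of `E/ℚ` (globally minimal `W`), `α = unitRoot W p`: indeed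
`1 - α⁻¹ = u · #Ẽ(𝔽_p)` with `u ∈ ℤ_pˣ` (`exists_unit_one_sub_unitRoot_inv`) and `#Ẽ(𝔽_p) ≥ 1`
(`reductionPointCount_pos`). Mazur–Tate–Teitelbaum 1986, §I.14: a good prime is not exceptional.
[cite: MazurTateTeitelbaum1986Invent, §I.14] -/
theorem levelZero_one_sub_unitRoot_inv_ne_zero (W : WeierstrassCurve ℚ) [W.IsGloballyMinimal]
    (p : ℕ) [Fact p.Prime] (hord : IsOrdinaryAt W p) :
    (1 : ℚ_[p]) - (unitRoot W p : ℚ_[p])⁻¹ ≠ 0 := by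
  haveI : NeZero p := ⟨(Fact.out : p.Prime).ne_zero⟩
  obtain ⟨u, hu⟩ := exists_unit_one_sub_unitRoot_inv p W hord
  rw [hu]
  refine mul_ne_zero (coe_units_ne_zero p u) ?_
  exact_mod_cast (W.reductionPointCount_pos p).ne'

/-- **`L_p(E,0) ≠ 0 ↔ L(E,1) ≠ 0`** at a good ordinary prime `p`, for the newform `f` of `E/ℚ`
(globally minimal `W`): the constant term of `L_p(E,T) = padicLFunction f (unitRoot W p)` is
`(1 - α⁻¹)² [0]⁺_f` (`constantCoeff_padicLFunction_unitRoot`, Mazur–Tate–Teitelbaum 1986, §I.14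
(14.3)) with `1 - α⁻¹ ≠ 0` (`levelZero_one_sub_unitRoot_inv_ne_zero`) and
`L(E,1) = [0]⁺_f · Ω⁺_f`, `Ω⁺_f > 0` (`IsNewformOf.entireLFunction_one_eq`,
`IsNewformOf.ratPlusSymbol_zero_mul_plusPeriod`, `IsNewform0.plusPeriod_pos_holds`).
[cite: MazurTateTeitelbaum1986Invent, §I.14 (14.3)] -/
theorem levelZero_constantCoeff_padicLFunction_ne_zero_iff (W : WeierstrassCurve ℚ) [W.IsElliptic]
    [W.IsGloballyMinimal] (p : ℕ) [Fact p.Prime] (hord : IsOrdinaryAt W p) {N : ℕ} [NeZero N]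
    {f : CuspForm (Gamma0 N) 2} (hf : IsNewformOf W f) :
    PowerSeries.constantCoeff (padicLFunction f (unitRoot W p : ℚ_[p])) ≠ 0 ↔
      W.entireLFunction 1 ≠ 0 := by
  rw [constantCoeff_padicLFunction_unitRoot hord hf]
  constructor
  · intro hc hL
    apply hc
    have hsym : ratPlusSymbol f 0 = 0 := by
      have hpos : 0 < plusPeriod f := IsNewform0.plusPeriod_pos_holds hf.1 hf.coeffField_eq_bot
      have h1 := hf.ratPlusSymbol_zero_mul_plusPeriod
      rw [hL, Complex.zero_re] at h1
      have h2 : ((ratPlusSymbol f 0 : ℚ) : ℝ) = 0 := (mul_eq_zero.mp h1).resolve_right hpos.ne'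
      exact_mod_cast h2
    rw [hsym, Rat.cast_zero, mul_zero]
  · intro hL
    have hsym : (ratPlusSymbol f 0 : ℚ) ≠ 0 := by
      intro h
      apply hL
      rw [hf.entireLFunction_one_eq, h]
      simp
    exact mul_ne_zero (pow_ne_zero _ (levelZero_one_sub_unitRoot_inv_ne_zero W p hord))
      (by exact_mod_cast hsym)

/-- **`ord_{T=0} L_p(E,T) = 0 ↔ L(E,1) ≠ 0`** at a good ordinary prime `p`, for the newform `f` of
`E/ℚ` (globally minimal `W`): the order of a power series is `0` iff its constant coefficient is
non-zero (`PowerSeries.order_eq_nat`), and `L_p(E,0) ≠ 0 ↔ L(E,1) ≠ 0`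
(`levelZero_constantCoeff_padicLFunction_ne_zero_iff`; Mazur–Tate–Teitelbaum 1986, §I.14 (14.3)).
[cite: MazurTateTeitelbaum1986Invent, §I.14 (14.3)] -/
theorem levelZero_order_padicLFunction_eq_zero_iff (W : WeierstrassCurve ℚ) [W.IsElliptic]
    [W.IsGloballyMinimal] (p : ℕ) [Fact p.Prime] (hord : IsOrdinaryAt W p) {N : ℕ} [NeZero N]
    {f : CuspForm (Gamma0 N) 2} (hf : IsNewformOf W f) :
    (padicLFunction f (unitRoot W p : ℚ_[p])).order = 0 ↔ W.entireLFunction 1 ≠ 0 := by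
  rw [← levelZero_constantCoeff_padicLFunction_ne_zero_iff W p hord hf,
    ← PowerSeries.coeff_zero_eq_constantCoeff_apply]
  have h0 : ((0 : ℕ) : ℕ∞) = 0 := Nat.cast_zero
  rw [← h0, PowerSeries.order_eq_nat]
  exact ⟨fun h ↦ h.1, fun h ↦ ⟨h, fun i hi ↦ absurd hi (Nat.not_lt_zero i)⟩⟩

/-- **Stub `stub_padicBSDrank_levelZero` of line `Sketch` (crux `PAdicOrderPadicBSDrankR2`,
stmt-0490): level zero, every good ordinary `p`, `p = 2` included.** Granting Kato's finiteness
theorem `L(E,1) ≠ 0 ⇒ Sel_{p^∞}(E/ℚ)` finite (named fact `kato_finite_of_L_one_ne_zero`, Kato 2004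
Cor. 14.3 = Kolyvagin): `ord_{T=0} L_p(E,T) = 0 ↔ ord_{s=1} L(E,s) = 0` (interpolation
`L_p(E,0) = (1-α⁻¹)² L(E,1)/Ω⁺_f`, `α ≠ 1`: `levelZero_order_padicLFunction_eq_zero_iff` and
`analyticRank_eq_zero_iff_holds`, `L(E,s)` being entire by `IsNewformOf.hasEntireLFunction`), and
then `corank_{ℤ_p} Sel_{p^∞}(E/ℚ) = 0` (a finite group has corank `0`:
`zpCorank_of_finite_eq_zero`). The first clause is unconditional; only the second uses `hKF`.
[cite: MazurTateTeitelbaum1986Invent, §I.14 (14.3)] [cite: Kato2004Asterisque, Cor. 14.3] -/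
theorem stub_padicBSDrank_levelZero
    (hKF : ∀ (W : WeierstrassCurve ℚ) [W.IsElliptic] (p : ℕ) [Fact p.Prime],
      kato_finite_of_L_one_ne_zero W p) :
    ∀ (W : WeierstrassCurve ℚ) [W.IsElliptic] [W.IsGloballyMinimal] (p : ℕ) [Fact p.Prime],
      IsOrdinaryAt W p → ∀ {N : ℕ} [NeZero N] (f : CuspForm (Gamma0 N) 2), IsNewformOf W f →
      ((padicLFunction f (unitRoot W p : ℚ_[p])).order = 0 ↔ W.analyticRank = 0) ∧
      ((padicLFunction f (unitRoot W p : ℚ_[p])).order = 0 → W.selmerCorank p = 0) := by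
  intro W _ _ p _ hord N _ f hf
  have hiff := levelZero_order_padicLFunction_eq_zero_iff W p hord hf
  refine ⟨hiff.trans (W.analyticRank_eq_zero_iff_holds hf.hasEntireLFunction).symm, fun h ↦ ?_⟩
  have hL : W.entireLFunction 1 ≠ 0 := hiff.mp h
  obtain ⟨-, -, hfin⟩ := hKF W p hL
  haveI := hfin
  unfold WeierstrassCurve.selmerCorank
  exact zpCorank_of_finite_eq_zero p

end Summit.BirchSwinnertonDyer.BirchSwinnertonDyer.Theorems
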